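import Literature.NumberTheory.LFunctions.WeilExplicitArchTermProofs
import Mathlib.MeasureTheory.Integral.ExpDecay
import HarnessLib

/-!
# T48a — Bombieri's expansion of `∫₀^∞ (e^{x/2}k(x) − k(0)) dx/(2 sinh x)` for continuous `k`

The tree expands Bombieri's integral as `Σₙ ∫₀^∞ (k(x)e^{−(2n+½)x} − k(0)e^{−(2n+1)x}) dx`
(`hasSum_integral_bombieriTerms`, `integral_bombieriTerm`) for SMOOTH compactly supported `k`,
smoothness being used only to get `‖e^{x/2}k(x) − k(0)‖ ≤ Mx` on `[0,1]`. This file records the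
same expansion under exactly that hypothesis, for continuous compactly supported `k`
(`hasSum_integral_bombieriTerms_of_le`, `integral_bombieriTerm_of_le`); it applies to the
symmetrised tent `x ↦ Δ_t(x) + Δ_t(−x)` (T45), whose numerator is `O(x)` by the Lipschitz bound.
The proofs are the tree's, with the hypothesis threaded through.
-/

noncomputable section

open scoped Real Topology
open Complex Filter Set MeasureTheory Literature.NumberTheory.LFunctions

namespace Summit.RiemannHypothesis.RiemannHypothesis.Theorems

variable {k : ℝ → ℂ}

/-- **Bombieri's integrand is absolutely integrable** for continuous compactly supported `k` with
`‖e^{x/2}k(x) − k(0)‖ ≤ Mx` on `[0,1]`: `‖e^{x/2}k(x) − k(0)‖/(2 sinh x)` is integrable on `(0,∞)`. -/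
theorem integrableOn_bombieriMajorant_of_le (hkc : Continuous k) (hks : HasCompactSupport k)
    (hM : ∃ M : ℝ, 0 ≤ M ∧ ∀ x ∈ Icc (0 : ℝ) 1, ‖(Real.exp (x / 2) : ℂ) * k x - k 0‖ ≤ M * x) :
    IntegrableOn (fun x : ℝ ↦ ‖(Real.exp (x / 2) : ℂ) * k x - k 0‖ / (2 * Real.sinh x))
      (Ioi 0) := by
  obtain ⟨M, hM0, hM⟩ := hM
  obtain ⟨K, hK⟩ := hkc.bounded_above_of_compact_support hks
  have hK0 : 0 ≤ K := (norm_nonneg _).trans (hK 0)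
  set C : ℝ := M / 2 * Real.exp (1 / 2) + 4 * K with hC
  have hC0 : 0 ≤ C := by positivity
  refine Integrable.mono' ((exp_neg_integrableOn_Ioi 0 (by norm_num : (0 : ℝ) < 1 / 2)).const_mul C)
    ?_ ?_
  · refine (Measurable.div ?_ ?_).aestronglyMeasurable
    · exact (by fun_prop : Continuous fun x : ℝ ↦ ‖(Real.exp (x / 2) : ℂ) * k x - k 0‖).measurable
    · exact (by fun_prop : Continuous fun x : ℝ ↦ 2 * Real.sinh x).measurable
  · refine (ae_restrict_iff' measurableSet_Ioi).2 (Eventually.of_forall fun x (hx : 0 < x) ↦ ?_)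
    have hsinh : 0 < Real.sinh x := Real.sinh_pos_iff.2 hx
    have h2s : 0 < 2 * Real.sinh x := by positivity
    rw [Real.norm_eq_abs, abs_of_nonneg (div_nonneg (norm_nonneg _) h2s.le), div_le_iff₀ h2s]
    rcases le_or_gt x 1 with hx1 | hx1
    · have e1 : 1 ≤ Real.exp (1 / 2) * Real.exp (-(1 / 2) * x) := by
        rw [← Real.exp_add]; exact Real.one_le_exp (by linarith)
      have e2 : x ≤ Real.sinh x := Real.self_le_sinh_iff.2 hx.le
      calc ‖(Real.exp (x / 2) : ℂ) * k x - k 0‖ ≤ M * x := hM x ⟨hx.le, hx1⟩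
        _ ≤ M * Real.sinh x := by gcongr
        _ ≤ M * Real.sinh x * (Real.exp (1 / 2) * Real.exp (-(1 / 2) * x)) :=
            le_mul_of_one_le_right (by positivity) e1
        _ = M / 2 * Real.exp (1 / 2) * Real.exp (-(1 / 2) * x) * (2 * Real.sinh x) := by ring
        _ ≤ C * Real.exp (-(1 / 2) * x) * (2 * Real.sinh x) := by
            gcongr
            rw [hC]
            linarith [mul_nonneg (by norm_num : (0 : ℝ) ≤ 4) hK0]
    · have hE1 : 1 ≤ Real.exp (x / 2) := Real.one_le_exp (by positivity)
      have hprod : Real.exp (-(1 / 2) * x) * Real.exp x = Real.exp (x / 2) := by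
        rw [← Real.exp_add]; ring_nf
      have hex1 : Real.exp (-x) ≤ 1 := Real.exp_le_one_iff.2 (by linarith)
      have hex2 : (2 : ℝ) ≤ Real.exp x := by linarith [Real.add_one_le_exp x]
      have h2s' : Real.exp x / 2 ≤ 2 * Real.sinh x := by rw [Real.sinh_eq]; linarith
      have hh : ‖(Real.exp (x / 2) : ℂ) * k x - k 0‖ ≤ Real.exp (x / 2) * K + K := by
        refine (norm_sub_le _ _).trans (add_le_add ?_ (hK 0))
        rw [norm_mul, Complex.norm_real, Real.norm_of_nonneg (Real.exp_pos _).le]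
        exact mul_le_mul_of_nonneg_left (hK x) (Real.exp_pos _).le
      calc ‖(Real.exp (x / 2) : ℂ) * k x - k 0‖ ≤ Real.exp (x / 2) * K + K := hh
        _ ≤ 2 * K * Real.exp (x / 2) := by nlinarith
        _ ≤ C / 2 * Real.exp (x / 2) := by
            gcongr
            rw [hC]
            nlinarith [Real.exp_pos (1 / 2)]
        _ = C * Real.exp (-(1 / 2) * x) * (Real.exp x / 2) := by rw [mul_assoc, ← hprod]; ring
        _ ≤ C * Real.exp (-(1 / 2) * x) * (2 * Real.sinh x) := by gcongr

/-- **Expansion of Bombieri's integral** for continuous compactly supported `k` with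
`‖e^{x/2}k(x) − k(0)‖ ≤ Mx` on `[0,1]`:
`Σₙ ∫₀^∞ (k(x) e^{−(2n+½)x} − k(0) e^{−(2n+1)x}) dx = ∫₀^∞ (e^{x/2} k(x) − k(0)) dx/(2 sinh x)`. -/
theorem hasSum_integral_bombieriTerms_of_le (hkc : Continuous k) (hks : HasCompactSupport k)
    (hM : ∃ M : ℝ, 0 ≤ M ∧ ∀ x ∈ Icc (0 : ℝ) 1, ‖(Real.exp (x / 2) : ℂ) * k x - k 0‖ ≤ M * x) :
    HasSum (fun n : ℕ ↦ ∫ x in Ioi (0 : ℝ),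
        (k x * cexp ((-(2 * (n : ℂ)) - 1 / 2) * x) - k 0 * cexp (-(2 * (n : ℂ) + 1) * x)))
      (∫ x in Ioi (0 : ℝ), ((Real.exp (x / 2) : ℂ) * k x - k 0) / (2 * Real.sinh x : ℂ)) := by
  have hF : ∀ (n : ℕ) (x : ℝ),
      k x * cexp ((-(2 * (n : ℂ)) - 1 / 2) * x) - k 0 * cexp (-(2 * (n : ℂ) + 1) * x) =
        cexp (-(2 * (n : ℂ) + 1) * x) * ((Real.exp (x / 2) : ℂ) * k x - k 0) := by
    intro n x
    have e1 : ((Real.exp (x / 2) : ℝ) : ℂ) = cexp ((x : ℂ) / 2) := by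
      rw [Complex.ofReal_exp]; push_cast; ring_nf
    rw [e1, mul_sub, ← mul_assoc, ← Complex.exp_add]
    have e2 : -(2 * (n : ℂ) + 1) * x + (x : ℂ) / 2 = (-(2 * (n : ℂ)) - 1 / 2) * x := by ring
    rw [e2]
    ring
  have hpowC : ∀ (n : ℕ) (x : ℝ), cexp (-(2 * (n : ℂ) + 1) * x) =
      cexp (-(x : ℂ)) * cexp (-(2 * (x : ℂ))) ^ n := by
    intro n x
    rw [← Complex.exp_nat_mul, ← Complex.exp_add]
    congr 1
    ring
  have hpowR : ∀ (n : ℕ) (x : ℝ), Real.exp (-(2 * (n : ℝ) + 1) * x) =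
      Real.exp (-x) * Real.exp (-(2 * x)) ^ n := by
    intro n x
    rw [← Real.exp_nat_mul, ← Real.exp_add]
    congr 1
    ring
  have hnormF : ∀ (n : ℕ) (x : ℝ),
      ‖cexp (-(2 * (n : ℂ) + 1) * x)‖ = Real.exp (-(2 * (n : ℝ) + 1) * x) := by
    intro n x
    have hcast : (-(2 * (n : ℂ) + 1) * (x : ℂ)) = ((-(2 * (n : ℝ) + 1) * x : ℝ) : ℂ) := by
      push_cast; ring
    rw [hcast, Complex.norm_exp, Complex.ofReal_re]
  simp_rw [hF]
  refine hasSum_integral_of_dominated_convergence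
    (fun (n : ℕ) (x : ℝ) ↦ Real.exp (-(2 * (n : ℝ) + 1) * x) * ‖(Real.exp (x / 2) : ℂ) * k x - k 0‖)
    (fun n ↦ ?_) (fun n ↦ Eventually.of_forall fun x ↦ ?_) ?_ ?_ ?_
  · exact (by fun_prop : Continuous fun x : ℝ ↦ cexp (-(2 * (n : ℂ) + 1) * x) *
      ((Real.exp (x / 2) : ℂ) * k x - k 0)).aestronglyMeasurable
  · rw [norm_mul, hnormF]
  · refine (ae_restrict_iff' measurableSet_Ioi).2 (Eventually.of_forall fun x (hx : 0 < x) ↦ ?_)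
    have h0 : 0 ≤ Real.exp (-(2 * x)) := (Real.exp_pos _).le
    have h1 : Real.exp (-(2 * x)) < 1 := Real.exp_lt_one_iff.2 (by linarith)
    have e : (fun n : ℕ ↦ Real.exp (-(2 * (n : ℝ) + 1) * x) * ‖(Real.exp (x / 2) : ℂ) * k x - k 0‖) =
        fun n : ℕ ↦ Real.exp (-x) * ‖(Real.exp (x / 2) : ℂ) * k x - k 0‖ *
          Real.exp (-(2 * x)) ^ n := by
      funext n; rw [hpowR]; ring
    rw [e]
    exact (summable_geometric_of_lt_one h0 h1).mul_left _
  · refine ((integrableOn_bombieriMajorant_of_le hkc hks hM).congr_fun (fun x (hx : 0 < x) ↦ ?_)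
      measurableSet_Ioi).integrable
    have h0 : 0 ≤ Real.exp (-(2 * x)) := (Real.exp_pos _).le
    have h1 : Real.exp (-(2 * x)) < 1 := Real.exp_lt_one_iff.2 (by linarith)
    have e : (fun n : ℕ ↦ Real.exp (-(2 * (n : ℝ) + 1) * x) * ‖(Real.exp (x / 2) : ℂ) * k x - k 0‖) =
        fun n : ℕ ↦ Real.exp (-x) * ‖(Real.exp (x / 2) : ℂ) * k x - k 0‖ *
          Real.exp (-(2 * x)) ^ n := by
      funext n; rw [hpowR]; ring
    show ‖(Real.exp (x / 2) : ℂ) * k x - k 0‖ / (2 * Real.sinh x) =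
      ∑' n : ℕ, Real.exp (-(2 * (n : ℝ) + 1) * x) * ‖(Real.exp (x / 2) : ℂ) * k x - k 0‖
    rw [e, tsum_mul_left, tsum_geometric_of_lt_one h0 h1, div_eq_mul_one_div,
      ← exp_neg_div_one_sub_exp hx]
    ring
  · refine (ae_restrict_iff' measurableSet_Ioi).2 (Eventually.of_forall fun x (hx : 0 < x) ↦ ?_)
    have hr : ‖cexp (-(2 * (x : ℂ)))‖ < 1 := by
      have hcast : (-(2 * (x : ℂ))) = ((-(2 * x) : ℝ) : ℂ) := by push_cast; ring
      rw [hcast, Complex.norm_exp, Complex.ofReal_re]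
      exact Real.exp_lt_one_iff.2 (by linarith)
    have hgeo := (hasSum_geometric_of_norm_lt_one hr).mul_left
      (cexp (-(x : ℂ)) * ((Real.exp (x / 2) : ℂ) * k x - k 0))
    have hC : cexp (-(x : ℂ)) / (1 - cexp (-(2 * (x : ℂ)))) = 1 / (2 * (Real.sinh x : ℂ)) := by
      have := congrArg (fun r : ℝ ↦ (r : ℂ)) (exp_neg_div_one_sub_exp hx)
      push_cast at this
      rw [Complex.ofReal_sinh]
      exact this
    have ef : (fun n : ℕ ↦ cexp (-(2 * (n : ℂ) + 1) * x) * ((Real.exp (x / 2) : ℂ) * k x - k 0)) =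
        fun n : ℕ ↦ cexp (-(x : ℂ)) * ((Real.exp (x / 2) : ℂ) * k x - k 0) *
          cexp (-(2 * (x : ℂ))) ^ n := by
      funext n
      rw [hpowC]
      ring
    have ev : ((Real.exp (x / 2) : ℂ) * k x - k 0) / (2 * (Real.sinh x : ℂ)) =
        cexp (-(x : ℂ)) * ((Real.exp (x / 2) : ℂ) * k x - k 0) *
          (1 - cexp (-(2 * (x : ℂ))))⁻¹ := by
      calc ((Real.exp (x / 2) : ℂ) * k x - k 0) / (2 * (Real.sinh x : ℂ))
          = ((Real.exp (x / 2) : ℂ) * k x - k 0) * (1 / (2 * (Real.sinh x : ℂ))) := by ring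
        _ = ((Real.exp (x / 2) : ℂ) * k x - k 0) *
            (cexp (-(x : ℂ)) / (1 - cexp (-(2 * (x : ℂ))))) := by rw [hC]
        _ = _ := by ring
    rw [ef, ev]
    exact hgeo

/-- The terms of Bombieri's expansion, for continuous compactly supported `k`:
`∫₀^∞ (k(x) e^{−(2n+½)x} − k(0) e^{−(2n+1)x}) dx = ∫₀^∞ k(x)e^{−(2n+½)x} dx − k(0)/(2n+1)`. -/
theorem integral_bombieriTerm_of_continuous (hkc : Continuous k) (hks : HasCompactSupport k)
    (n : ℕ) :
    ∫ x in Ioi (0 : ℝ),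
        (k x * cexp ((-(2 * (n : ℂ)) - 1 / 2) * x) - k 0 * cexp (-(2 * (n : ℂ) + 1) * x)) =
      (∫ x in Ioi (0 : ℝ), k x * cexp ((-(2 * (n : ℂ)) - 1 / 2) * x)) -
        k 0 / (2 * (n : ℂ) + 1) := by
  have hn : (0 : ℝ) ≤ n := n.cast_nonneg
  have ha : (-(2 * (n : ℂ) + 1)).re < 0 := by simp; linarith
  have hi1 : IntegrableOn (fun x : ℝ ↦ k x * cexp ((-(2 * (n : ℂ)) - 1 / 2) * x)) (Ioi 0) :=
    ((hkc.mul (by fun_prop)).integrable_of_hasCompactSupport hks.mul_right).integrableOn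
  have hi2 : IntegrableOn (fun x : ℝ ↦ k 0 * cexp (-(2 * (n : ℂ) + 1) * x)) (Ioi 0) :=
    (integrableOn_exp_mul_complex_Ioi ha 0).const_mul _
  rw [integral_sub hi1 hi2, integral_const_mul, integral_exp_mul_complex_Ioi ha 0]
  congr 1
  rw [Complex.ofReal_zero, mul_zero, Complex.exp_zero, neg_div_neg_eq, mul_one_div]

/-- **Bombieri's integral as a series**, packaged: for continuous compactly supported `k` with
`‖e^{x/2}k(x) − k(0)‖ ≤ Mx` on `[0,1]`,
`Σₙ (∫₀^∞ k(x)e^{−(2n+½)x} dx − k(0)/(2n+1)) = ∫₀^∞ (e^{x/2} k(x) − k(0)) dx/(2 sinh x)`. -/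
theorem hasSum_bombieriIntegral_of_le (hkc : Continuous k) (hks : HasCompactSupport k)
    (hM : ∃ M : ℝ, 0 ≤ M ∧ ∀ x ∈ Icc (0 : ℝ) 1, ‖(Real.exp (x / 2) : ℂ) * k x - k 0‖ ≤ M * x) :
    HasSum (fun n : ℕ ↦ (∫ x in Ioi (0 : ℝ), k x * cexp ((-(2 * (n : ℂ)) - 1 / 2) * x)) -
        k 0 / (2 * (n : ℂ) + 1))
      (∫ x in Ioi (0 : ℝ), ((Real.exp (x / 2) : ℂ) * k x - k 0) / (2 * Real.sinh x : ℂ)) := by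
  have h := hasSum_integral_bombieriTerms_of_le hkc hks hM
  simp_rw [integral_bombieriTerm_of_continuous hkc hks] at h
  exact h

end Summit.RiemannHypothesis.RiemannHypothesis.Theorems

end
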